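import Literature.NumberTheory.Automorphic.UnitaryThreeFixedPointsCount
import Literature.NumberTheory.Automorphic.UnitaryThreeTorusDoubleCosetsHK
import Literature.NumberTheory.Automorphic.UnitaryThreeTorusDoubleCosetsHKDisjoint
import Literature.NumberTheory.Automorphic.UnitaryThreeTorusDoubleCosetsHKWeight
import Literature.NumberTheory.Rogawski1990.UnitOrbitalIntegralInertCountJPosTorus
import Literature.NumberTheory.Rogawski1990.UnitOrbitalIntegralInertCountJPosVanishing
import Literature.NumberTheory.Rogawski1990.UnitOrbitalIntegralInertReindex
import Literature.NumberTheory.Rogawski1990.UnitOrbitalIntegralInertValuesTheta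
import HarnessLib

/-!
# Flicker's count at `θ̄ = 0`, H-level: `Σ_m #Fix_t(H ⧸ H^K_m) = φ₀(N₁, N₂, N)` from the `j = 0` column (LAYER C, value `X₁`)
(Flicker (1998), *Elementary proof of the fundamental lemma for a unitary group*, Prop. 5 p. 82, Cor. 9 p. 85, Prop. 10 pp. 85–86, Prop. 13 pp. 91–93, Prop. 14 p. 94)

Topic `NumberTheory/Rogawski1990` (road «D-N7-inert», MAP v3 LAYER C, the `θ̄ = 0` value `X₁ = φ₀`); namespace `Literature.NumberTheory.Automorphic.UnitaryGroup`.
THEOREMS ONLY: no definition, no named fact, no instance, no notation, no `sorry`; kernel lane.  Pen F0P3b-p01 (g6) (A-p03 (g24) split 06:00:11Z: A-p03 = θ̄ = 1,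
F0P3b-p01 = θ̄ = 0; census `F0/P3/F0P3b-p01/g6/CENSUS-LayerC-X1-ThetaZero.F0P3bp01g6.md`, layer T1a).  HONEST LABEL: HC_CM is proved only modulo the 2 remaining named
inputs (hLiu418, h413) until rung 0 closes; this file is a junction (no new mathematics) and proves no letter by itself.

THE STATEMENT (`finsum_natCard_fixedPoints_eq_phiZero_of_column`).  `t = t(a,b,c) = !![e(a+c),0,−e(a−c); 0,b,0; −e(a−c),0,e(a+c)] ∈ H = Z_U(c)` (Flicker's torus at
`θ = 1`), `η_m` the level elements (`hum`), `r_i = diag(ϖ^{−i}, 1, ϖ^i)` the radial family, `N = ord(a−c)`, `N₊ = ord(a+c−2b)`.  THEN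
`Σᶠ_m #{z ∈ H ⧸ H^K_m : t·z = z} = phiZero q N₁ N₂ N` (in `ℚ`), GIVEN the `j = 0` COLUMN `#{y ∈ P_H ⧸ P_H ∩ H^K_m : y⁻¹ t y ∈ H^K_m} = iThirteen q N N₊ (max N₁ N₂) m` for every `m`
as the binder `hI0` (paid by ★ `natCard_cosets_flickerTorusOne_eq_iThirteen` for `m ≤ N` and ★ p04 `natCard_cosets_jzero_eq_iThirteen_of_lt` for `N < m`, the latter modulo
its case-(e) count `hce`).  ASSEMBLY: ★ B-p04 Cor. 9 `natCard_fixedPoints_centralizer_eq_finsum` (decomposition `H = ⊔ T r_i K_H`, ★ B-p12 `exists_mem_centralizer_mul_diagRadial…`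
∕ `eq_of_centralizer_mul_diagRadial…` at `ε = 0`) → weights ★ B-p12 `relIndex_flickerKH_conj_diagRadial_eq` = `corNineWeight q (2i)` (★ `natCast_weight_eq_corNineWeight`) → columns
`j = 2i ≥ 2`: ★ A-p03 `natCard_cosets_flickerTorus_eq_iTen` (`2i ≤ N`), ★ `natCard_cosets_flickerTorus_eq_zero_of_lt` (`N < 2i`) → re-index ★ `finsum_comp_two_mul_eq_finsum_ite` →
★ `finsum_natCast_eq_phiZero` (Prop. 14's `θ̄ = 0` table identity, regime datum `h`).

## References
* [Flicker1998UnitaryFL] Y. Z. Flicker, *Elementary proof of the fundamental lemma for a unitary group*, Canad. J. Math. 50 (1998), 74–98.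
* [Rogawski1990] J. D. Rogawski, *Automorphic Representations of Unitary Groups in Three Variables* (1990), §4.9 p. 55.
-/

set_option autoImplicit false

open scoped MatrixGroups WithZero Valued
open Matrix

namespace Literature.NumberTheory.Automorphic

namespace UnitaryGroup

open Literature.NumberTheory.Automorphic.HermitianLattice (unitaryInt mem_unitaryInt_iff LocalConjDatum)
open Literature.NumberTheory.Rogawski1990.Flicker1998 (iThirteen iTen corNineWeight phiZero natCast_weight_eq_corNineWeight finsum_natCast_eq_phiZero
  finsum_comp_two_mul_eq_finsum_ite)
open IsLocalRing

universe u

variable {K : Type*} [Field K] [Valued K ℤᵐ⁰] {ϖ : K} (σ : K →+* K) {J : Matrix (Fin 3) (Fin 3) K}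

section ThetaZero

variable [IsDiscreteValuationRing 𝒪[K]] [Finite (ResidueField 𝒪[K])] [IsAdicComplete (maximalIdeal 𝒪[K]) 𝒪[K]]

set_option synthInstance.maxHeartbeats 120000 in
-- the `MulAction` instance of `↥H` on `↥H ⧸ M` (as in ★ `natCard_fixedPoints_centralizer_eq_finsum`)
/-- **`Σᶠ_m #Fix_t(H ⧸ H^K_m) = φ₀(N₁,N₂,N)` for the torus `t(a,b,c)` (`θ̄ = 0`), FROM THE `j = 0` COLUMN `hI0`.**  Flicker: Prop. 5's sum of Cor. 9's expansions,
`#Fix_t(H ⧸ H^K_m) = Σ_i [K_H^{r_i} : T ∩ K_H^{r_i}] · ∫_{P_H} 1_{H^K_m}(p⁻¹ r_i⁻¹ t r_i p)`, the weights `1, (q+1)q^{2i−1}` and the columns Prop. 13 (`i = 0`) ∕ Prop. 10 (`j = 2i ≤ N`) ∕ `0`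
(`2i > N`), summed by Prop. 14's `θ̄ = 0` identity. [cite: Flicker1998UnitaryFL, Prop. 5 p. 82; Cor. 9 p. 85; Prop. 10 p. 85; Prop. 13 p. 91; Prop. 14 p. 94] -/
theorem finsum_natCard_fixedPoints_eq_phiZero_of_column (hJ : J = (StdForm.antidiagonal 3).over K) (hd : LocalConjDatum σ ϖ)
    (hσO : ∀ y : 𝒪[K], (σ.comp 𝒪[K].subtype) y ∈ 𝒪[K]) {y : K} (hy : y * σ y = -2)
    {c : ↥(unitaryGroupOfForm σ J)} (hc : ((c : GL (Fin 3) K) : Matrix (Fin 3) (Fin 3) K) = !![1, 0, 0; 0, -1, 0; 0, 0, 1])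
    (u : ℕ → ↥(unitaryGroupOfForm σ J))
    (hum : ∀ m, ((u m : GL (Fin 3) K) : Matrix (Fin 3) (Fin 3) K) = !![ϖ ^ m, y, (ϖ ^ m)⁻¹; 0, 1, -σ y * (ϖ ^ m)⁻¹; 0, 0, (ϖ ^ m)⁻¹])
    -- the integer frame of ★ `relIndex_flickerKH_conj_diagRadial_eq`
    {R : Type u} [CommRing R] [IsDomain R] [IsDiscreteValuationRing R] [Finite (ResidueField R)] (ι : R →+* K) (hι : Function.Injective ι)
    (hιv : ∀ x : K, Valued.v x ≤ 1 ↔ x ∈ Set.range ι) (σR : R →+* R) (hσR : ∀ r, σR (σR r) = r) (hσι : ∀ r, ι (σR r) = σ (ι r))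
    {dR : R} (hdRσ : σR dR = -dR) (hdRu : IsUnit dR) (h2R : IsUnit (2 : R)) {ϖR : R} (hϖR : Irreducible ϖR) (hιϖ : ι ϖR = ϖ)
    {q : ℕ} (hqR : Nat.card (ResidueField R) = q ^ 2) (hq : Nat.card (ResidueField 𝒪[K]) = q ^ 2)
    {a₀ : 𝒪[K]} (ha₀ : IsUnit (((σ.comp 𝒪[K].subtype).codRestrict 𝒪[K] hσO) a₀ - a₀))
    -- the torus element and the radial family
    {e a b cc : K} (h2e : 2 * e = 1) (ha : σ a * a = 1) (hb : σ b * b = 1) (hcc : σ cc * cc = 1)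
    {t : ↥(unitaryGroupOfForm σ J)}
    (hte : ((t : GL (Fin 3) K) : Matrix (Fin 3) (Fin 3) K) = !![e * (a + cc), 0, -(e * (a - cc)); 0, b, 0; -(e * (a - cc)), 0, e * (a + cc)])
    (htH : t ∈ Subgroup.centralizer ({c} : Set ↥(unitaryGroupOfForm σ J)))
    (r : ℕ → ↥(Subgroup.centralizer ({c} : Set ↥(unitaryGroupOfForm σ J))))
    (hr : ∀ i, (((r i : ↥(unitaryGroupOfForm σ J)) : GL (Fin 3) K) : Matrix (Fin 3) (Fin 3) K) = !![(ϖ ^ i)⁻¹, 0, 0; 0, 1, 0; 0, 0, ϖ ^ i])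
    -- orders, regime, the `j = 0` column, finiteness
    {N Np N₁ N₂ : ℕ} (hN : Valued.v (a - cc) = Valued.v (ϖ ^ N)) (hNp : Valued.v (a + cc - 2 * b) = Valued.v (ϖ ^ Np))
    (h : (N₁ < N ∧ N₂ = N₁ ∧ Np = N₁) ∨ (N ≤ N₁ ∧ N ≤ Np))
    (hI0 : ∀ m, (Nat.card {w : ↥(flickerPH σ J c) ⧸ (flickerHK σ J c (u m)).subgroupOf (flickerPH σ J c) //
      ((Quotient.out w : ↥(flickerPH σ J c)) : ↥(unitaryGroupOfForm σ J))⁻¹ * t * (Quotient.out w : ↥(flickerPH σ J c)) ∈ flickerHK σ J c (u m)} : ℚ) =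
        iThirteen q N Np (max N₁ N₂) m)
    (hfin : ∀ m, {x : ↥(Subgroup.centralizer ({c} : Set ↥(unitaryGroupOfForm σ J))) ⧸
      (flickerHK σ J c (u m)).subgroupOf (Subgroup.centralizer ({c} : Set ↥(unitaryGroupOfForm σ J))) |
        (⟨t, htH⟩ : ↥(Subgroup.centralizer ({c} : Set ↥(unitaryGroupOfForm σ J)))) • x = x}.Finite) :
    ∑ᶠ m, (Nat.card {x : ↥(Subgroup.centralizer ({c} : Set ↥(unitaryGroupOfForm σ J))) ⧸
        (flickerHK σ J c (u m)).subgroupOf (Subgroup.centralizer ({c} : Set ↥(unitaryGroupOfForm σ J))) //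
        (⟨t, htH⟩ : ↥(Subgroup.centralizer ({c} : Set ↥(unitaryGroupOfForm σ J)))) • x = x} : ℚ) = phiZero q N₁ N₂ N := by
  classical
  have h2v : Valued.v (2 : K) = 1 := hd.v2
  have h2 : (2 : K) ≠ 0 := fun h => by rw [h, map_zero] at h2v; exact zero_ne_one h2v
  have hϖ0 : ϖ ≠ 0 := hd.ϖ_ne_zero
  have he0 : e ≠ 0 := fun h => by rw [h, mul_zero] at h2e; exact zero_ne_one h2e
  have hac : a ≠ cc := by
    intro h; rw [h, sub_self, map_zero] at hN; exact (pow_ne_zero _ hϖ0) ((map_eq_zero _).1 hN.symm)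
  have hC : -(e * (a - cc)) ≠ 0 := neg_ne_zero.2 (mul_ne_zero he0 (sub_ne_zero.2 hac))
  have hq0 : q ≠ 0 := by
    rintro rfl
    have h1 : 0 < Nat.card (ResidueField 𝒪[K]) := Nat.card_pos
    rw [hq] at h1; simp at h1
  have hq1 : 1 ≤ q := Nat.one_le_iff_ne_zero.2 hq0
  have hq2 : 1 < q := by
    by_contra hle
    have hq1' : q = 1 := by omega
    haveI : Nontrivial (ResidueField 𝒪[K]) := inferInstance
    have h1 : 1 < Nat.card (ResidueField 𝒪[K]) := Finite.one_lt_card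
    rw [hq, hq1', one_pow] at h1; exact lt_irrefl _ h1
  -- `T = Z_H(t)` commutes with `t`
  have hT : ∀ τ ∈ Subgroup.centralizer ({(⟨t, htH⟩ : ↥(Subgroup.centralizer ({c} : Set ↥(unitaryGroupOfForm σ J))))} : Set ↥(Subgroup.centralizer ({c} : Set ↥(unitaryGroupOfForm σ J)))), τ * (⟨t, htH⟩ : ↥(Subgroup.centralizer ({c} : Set ↥(unitaryGroupOfForm σ J)))) = (⟨t, htH⟩ : ↥(Subgroup.centralizer ({c} : Set ↥(unitaryGroupOfForm σ J)))) * τ :=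
    fun τ hτ => ((Subgroup.mem_centralizer_iff.1 hτ) (⟨t, htH⟩ : ↥(Subgroup.centralizer ({c} : Set ↥(unitaryGroupOfForm σ J)))) (Set.mem_singleton _)).symm
  -- ★ B-p12 γ2: cover and disjointness at `ε = 0`, `θ = θ′ = 1`
  have hθε : (1 : K) = ϖ ^ 0 := (pow_zero ϖ).symm
  have hθ : (1 : K) * 1 = 1 := mul_one 1
  have hBC : -(e * (a - cc)) * (1 : K) = -(e * (a - cc)) * 1 := rfl
  have hA := fun g => exists_mem_centralizer_mul_diagRadial_mul_mem_flickerKH σ hJ hd ι hι hιv σR hσR hσι hdRσ hdRu h2R hϖR hιϖ hc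
    (Nat.zero_le 1) hθε hθ htH hte hC hBC r hr g
  have hB := eq_of_centralizer_mul_diagRadial_mul_flickerKH_eq σ hJ hd hc hθε hθ htH hte hC hBC r hr
  -- the weights
  have hW : ∀ i, ((((flickerKH σ J c).subgroupOf (Subgroup.centralizer ({c} : Set ↥(unitaryGroupOfForm σ J)))).map (MulAut.conj (r i)).toMonoidHom).relIndex
      (Subgroup.centralizer ({(⟨t, htH⟩ : ↥(Subgroup.centralizer ({c} : Set ↥(unitaryGroupOfForm σ J))))} : Set ↥(Subgroup.centralizer ({c} : Set ↥(unitaryGroupOfForm σ J))))) : ℚ) = corNineWeight q (2 * i) := by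
    intro i
    rw [relIndex_flickerKH_conj_diagRadial_eq σ hJ hd ι hι hιv σR hσR hσι hdRσ hdRu h2R hϖR hιϖ hqR hc hθε hθ htH hte hC hBC r hr i,
      show 2 * i + 0 = 2 * i from rfl, ← natCast_weight_eq_corNineWeight hq1 (2 * i)]
  -- the columns `I(j, m)`
  set I : ℕ → ℕ → ℚ := fun j m => if j = 0 then iThirteen q N Np (max N₁ N₂) m else if j ≤ N then iTen q (N - j) Np m else 0 with hIdef
  have hte1 : ((t : GL (Fin 3) K) : Matrix (Fin 3) (Fin 3) K) =
      !![e * (a + cc), 0, -(e * (a - cc) * 1); 0, b, 0; -(e * (a - cc) * 1), 0, e * (a + cc)] := by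
    rw [hte, mul_one]
  have hr' : ∀ i, (((r i : ↥(unitaryGroupOfForm σ J)) : GL (Fin 3) K) : Matrix (Fin 3) (Fin 3) K) = !![ϖ⁻¹ ^ i, 0, 0; 0, 1, 0; 0, 0, ϖ ^ i] := by
    intro i; rw [hr i, inv_pow]
  have hr0 : (r 0 : ↥(unitaryGroupOfForm σ J)) = 1 := by
    apply Subtype.ext; apply Units.ext
    rw [hr 0, pow_zero, inv_one]
    ext i j; fin_cases i <;> fin_cases j <;> rfl
  have hcol : ∀ i m, (Nat.card {w : ↥(flickerPH σ J c) ⧸ (flickerHK σ J c (u m)).subgroupOf (flickerPH σ J c) //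
      ((Quotient.out w : ↥(flickerPH σ J c)) : ↥(unitaryGroupOfForm σ J))⁻¹ *
        (((r i)⁻¹ * (⟨t, htH⟩ : ↥(Subgroup.centralizer ({c} : Set ↥(unitaryGroupOfForm σ J)))) * r i : ↥(Subgroup.centralizer ({c} : Set ↥(unitaryGroupOfForm σ J)))) : ↥(unitaryGroupOfForm σ J)) * (Quotient.out w : ↥(flickerPH σ J c)) ∈ flickerHK σ J c (u m)} : ℚ) = I (2 * i) m := by
    intro i m
    have hconj : (((r i)⁻¹ * (⟨t, htH⟩ : ↥(Subgroup.centralizer ({c} : Set ↥(unitaryGroupOfForm σ J)))) * r i : ↥(Subgroup.centralizer ({c} : Set ↥(unitaryGroupOfForm σ J)))) : ↥(unitaryGroupOfForm σ J)) =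
        (r i : ↥(unitaryGroupOfForm σ J))⁻¹ * t * (r i : ↥(unitaryGroupOfForm σ J)) := rfl
    rw [hconj]
    rcases Nat.eq_zero_or_pos i with rfl | hi
    · rw [hr0, inv_one, one_mul, mul_one, hI0 m, hIdef]; simp
    by_cases hiN : 2 * i ≤ N
    · rw [natCard_cosets_flickerTorus_eq_iTen σ hJ hd hσO hy hc (hum m) h2e (θbar := 0) hθε (by rw [pow_zero, inv_one]) ha hb hcc hte1 htH
        (hr' i) (r i).2 hN hNp (by omega) (by omega) hq ha₀, hIdef]
      simp only [add_zero]
      rw [if_neg (by omega), if_pos hiN]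
    · rw [natCard_cosets_flickerTorus_eq_zero_of_lt σ hJ hd hy hc (hum m) h2e (θbar := 0) (by rw [pow_zero, inv_one]) hte1 htH (hr' i) (r i).2 hN
        (by omega), Nat.cast_zero, hIdef]
      simp only
      rw [if_neg (by omega), if_neg (by omega)]
  -- Cor. 9 at each level, in `ℚ`
  have hlevel : ∀ m, (Nat.card {x : ↥(Subgroup.centralizer ({c} : Set ↥(unitaryGroupOfForm σ J))) ⧸ (flickerHK σ J c (u m)).subgroupOf (Subgroup.centralizer ({c} : Set ↥(unitaryGroupOfForm σ J))) // (⟨t, htH⟩ : ↥(Subgroup.centralizer ({c} : Set ↥(unitaryGroupOfForm σ J)))) • x = x} : ℚ) =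
      ∑ᶠ j, (if j % 2 = 0 then corNineWeight q j * I j m else 0) := by
    intro m
    rw [natCard_fixedPoints_centralizer_eq_finsum σ hJ hd hy m (hum m) hc r (⟨t, htH⟩ : ↥(Subgroup.centralizer ({c} : Set ↥(unitaryGroupOfForm σ J))))
      (Subgroup.centralizer ({(⟨t, htH⟩ : ↥(Subgroup.centralizer ({c} : Set ↥(unitaryGroupOfForm σ J))))} : Set ↥(Subgroup.centralizer ({c} : Set ↥(unitaryGroupOfForm σ J))))) hT hA hB (hfin m)]
    have hsupp : (Function.support fun i => (((flickerKH σ J c).subgroupOf (Subgroup.centralizer ({c} : Set ↥(unitaryGroupOfForm σ J)))).map (MulAut.conj (r i)).toMonoidHom).relIndex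
        (Subgroup.centralizer ({(⟨t, htH⟩ : ↥(Subgroup.centralizer ({c} : Set ↥(unitaryGroupOfForm σ J))))} : Set ↥(Subgroup.centralizer ({c} : Set ↥(unitaryGroupOfForm σ J))))) *
        Nat.card {w : ↥(flickerPH σ J c) ⧸ (flickerHK σ J c (u m)).subgroupOf (flickerPH σ J c) //
          ((Quotient.out w : ↥(flickerPH σ J c)) : ↥(unitaryGroupOfForm σ J))⁻¹ *
            (((r i)⁻¹ * (⟨t, htH⟩ : ↥(Subgroup.centralizer ({c} : Set ↥(unitaryGroupOfForm σ J)))) * r i : ↥(Subgroup.centralizer ({c} : Set ↥(unitaryGroupOfForm σ J)))) : ↥(unitaryGroupOfForm σ J)) * (Quotient.out w : ↥(flickerPH σ J c)) ∈ flickerHK σ J c (u m)}).Finite := by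
      refine (Set.finite_Iic N).subset fun i hi => ?_
      rw [Function.mem_support] at hi
      by_contra hgt
      rw [Set.mem_Iic, not_le] at hgt
      apply hi
      have hconj : (((r i)⁻¹ * (⟨t, htH⟩ : ↥(Subgroup.centralizer ({c} : Set ↥(unitaryGroupOfForm σ J)))) * r i : ↥(Subgroup.centralizer ({c} : Set ↥(unitaryGroupOfForm σ J)))) : ↥(unitaryGroupOfForm σ J)) =
          (r i : ↥(unitaryGroupOfForm σ J))⁻¹ * t * (r i : ↥(unitaryGroupOfForm σ J)) := rfl
      rw [hconj, natCard_cosets_flickerTorus_eq_zero_of_lt σ hJ hd hy hc (hum m) h2e (θbar := 0) (by rw [pow_zero, inv_one]) hte1 htH (hr' i) (r i).2 hN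
        (by omega), mul_zero]
    have hcast := (Nat.castAddMonoidHom ℚ).map_finsum hsupp
    simp only [Nat.coe_castAddMonoidHom] at hcast
    rw [hcast, ← finsum_comp_two_mul_eq_finsum_ite (fun j => corNineWeight q j * I j m)]
    refine finsum_congr fun i => ?_
    rw [Nat.cast_mul, hW i, hcol i m]
  -- Prop. 14's `θ̄ = 0` identity
  have h0 : ∀ m, I 0 m = iThirteen q N Np (max N₁ N₂) m := fun m => by rw [hIdef]; simp
  have hpos : ∀ j m, 1 ≤ j → j ≤ N → I j m = iTen q (N - j) Np m := fun j m hj hjN => by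
    rw [hIdef]; simp only; rw [if_neg (by omega), if_pos hjN]
  have hbig : ∀ j m, N < j → I j m = 0 := fun j m hj => by
    rw [hIdef]; simp only; rw [if_neg (by omega), if_neg (by omega)]
  exact finsum_natCast_eq_phiZero q I h0 hpos hbig hq2 rfl h _ hlevel

end ThetaZero

end UnitaryGroup

end Literature.NumberTheory.Automorphic
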